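import Mathlib
import Summits.KontsevichZagierPeriods.Zeta5Search.ABFamilyFPCellsA
import Summits.KontsevichZagierPeriods.Zeta5Search.ABFamilyFPCellsB
import Summits.KontsevichZagierPeriods.Zeta5Search.ABFamilyFPCellsC
import Summits.KontsevichZagierPeriods.Zeta5Search.ABFamilyFPCellsD
import Summits.KontsevichZagierPeriods.Zeta5Search.ABFamilyFPCellsE
import Summits.KontsevichZagierPeriods.Zeta5Search.ABFamilyFPCellsF
import Summits.KontsevichZagierPeriods.Zeta5Search.ABFamilyFPCellsG
import Summits.KontsevichZagierPeriods.Zeta5Search.TS3RayCellsG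
import Summits.KontsevichZagierPeriods.Zeta5Search.TS3RayCellsI
import Summits.KontsevichZagierPeriods.Zeta5Search.FlagRayCasLB
import Summits.KontsevichZagierPeriods.Zeta5Search.LawA4Proof
import Summits.KontsevichZagierPeriods.Zeta5Search.DenomLaw.PathWeightProfile
import HarnessLib

/-!
# ζ(5) search — the A/B linear family `n·(3t+14; t+6,…,t)`: class bound on `(t+7)n < p ≤ (t+13)n`, the DEEP cells by THEOREM L5 / A⁗′ in the frame `(10,[1,−6,−6,1])`, and `C⋆` — ALL `t`, ALL `n`

Cell `pub-zeta5` (HONEST FRAMING: systematic search; no irrationality claim unless certified), TRACK «DENOM-LAW» D1 prover seat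
(denom-prover-d1 g16, `HOME/denom-law/prover-d1/ATTEMPT-16.md` §7).  The A/B linear family `bLin (t n) (t n + 2n) n = n·(3t+14; t+6, t+5, …, t)`
(`b₀ = (3t+14)n`, `d = (2t+21)n`, pair blocks `(t+3)n, …, (t+13)n`; the dual rays of the census directions A14, A15, A16, A18, B20, X3 =
`t = 11, 12, 13, 15, 17, 14`, on which engine-d2's rule R was found; gen 2/3 proved the rule-R2 strip `(t+2)n < p ≤ (t+7)n`, `RuleRAB.ruleR2_strip`).
From the machine-generated covers `ABFamilyFPCellsA–G`: §0 kit (parameter values, window facts for the first period `2p > (t+13)n`, the parity flag);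
§1 `casLB ≥ −9, −7, −5, −3, −1, 0` on `(t+7,t+8], …, (t+12,t+13]` (`θ = p/n`; all `t ≥ 8`; two checks are literally TOP_STAIR #3's `StairTS3.checkM_c36/c41` — the same type lists — and are cited); §2 THE DEEP CELLS `(t+13)n < 2p`, `p ≤ (t+2)n` (all 21 blocks
reach `p`, `N_p = 21`): exactly as on the TOP family (`DenomLaw/TopFamilyFPDeep`), the six clauses `DenomLaw.checkL5` hold in the ONE frame
`(M,T) = (10, [1,−6,−6,1])` on every deep cell and both parities, so THEOREM L5 (`DenomLaw.cover_L5`) gives `v ≥ −12` where `3p ≤ d` (`cas_ge_e3`) and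
THEOREM A⁗′ (`clausesL5_of_cover` + `RecordWindowsA4.lawA4_apply lawA4_holds`) gives `v ≥ −13` where `⌊d/p⌋ = 2` (`cas_ge_e2`) — the PATH values;
§3 `C⋆ ≤ 10, 9, 8, 7, 6, 5, 4, 3` for `p > (t+2)n, …, (t+6)n, (t+8)n, (t+9)n, (t+10)n` by the t-independent profile (`decide +kernel`).  Consumed by
`DenomLaw/ABFamilyFPPath`.  Direction `j = 7` (the node's).  MODEL/structure-side bookkeeping; nothing about ζ(5); no γ; records in print UNMOVED.
-/

open Finset

namespace Summit.KontsevichZagierPeriods.Zeta5Search.ABFamFP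

open Summit.KontsevichZagierPeriods.Zeta5Search.ClusterValuation
open Summit.KontsevichZagierPeriods.Zeta5Search.CasoratianValuation (InPolytope shift casoratian pairFloors refund)
open Summit.KontsevichZagierPeriods.Zeta5Search.WedgeDictionary (dOf)
open Summit.KontsevichZagierPeriods.Zeta5Search.ClassTypeCover
open Summit.KontsevichZagierPeriods.Zeta5Search.CellKit
open Summit.KontsevichZagierPeriods.Zeta5Search.RuleRAB (ab_zero dOf_ab inPolytope_ab inPolytope_shift_ab)
open Summit.KontsevichZagierPeriods.Zeta5Search.StairFLAG (casLB_of_cover')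
open Summit.KontsevichZagierPeriods.Zeta5Search.DenomLaw (cStar checkL5 cover_L5 clausesL5_of_cover)
open Summit.KontsevichZagierPeriods.Zeta5Search.DenomLaw.FirstPeriodKit (cStar_le_of_profile)
open Summit.KontsevichZagierPeriods.Zeta5Search.RecordWindowsA4 (lawA4_apply)
open Summit.KontsevichZagierPeriods.Zeta5Search.SecondOrder (lawA4_holds)

/-! ## §0 Kit -/

/-- From `a·n < t·n` to `(a+1)·n ≤ t·n` (the atom `t·n` for `omega`). -/
theorem succ_mul_le_of_mul_lt {a t n : ℕ} (h : a * n < t * n) : (a + 1) * n ≤ t * n :=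
  Nat.mul_le_mul_right n (Nat.lt_of_mul_lt_mul_right h)

/-- The family's lower parameters: `b_{i+1} = (t + 6 − i)·n` for `i < 7`. -/
theorem ab_param (t n : ℕ) (i : Fin 7) : bLin (t * n) (t * n + 2 * n) n (i.val + 1) = ((t : ℤ) + 6 - (i.val : ℤ)) * n := by
  fin_cases i <;> simp [bLin] <;> ring

/-- The family's pair blocks: `b₀ − b_{i+1} − b_{k+1} = (t + i + k + 2)·n`. -/
theorem ab_block (t n : ℕ) (i k : Fin 7) :
    bLin (t * n) (t * n + 2 * n) n 0 - bLin (t * n) (t * n + 2 * n) n (i.val + 1) - bLin (t * n) (t * n + 2 * n) n (k.val + 1)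
      = ((t : ℤ) + i.val + k.val + 2) * n := by
  rw [ab_param, ab_param, ab_zero]; push_cast; ring

/-- `b₆ = (t+1)n` and `b₇ = tn` (pushed casts). -/
theorem ab_six_seven (t n : ℕ) : bLin (t * n) (t * n + 2 * n) n 6 = (t : ℤ) * n + n ∧ bLin (t * n) (t * n + 2 * n) n 7 = (t : ℤ) * n := by
  have h6 := ab_param t n ⟨5, by norm_num⟩
  have h7 := ab_param t n ⟨6, by norm_num⟩
  simp only at h6 h7
  refine ⟨?_, ?_⟩
  · rw [h6]; push_cast; ring
  · rw [h7]; push_cast; ring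

/-- Window facts for the first period `(t+13)n < 2p` (`t ≥ 8`, `n ≥ 1`): `5 ≤ p` and `b₀ + 2 < p²` (`p ≥ 11` and `2p ≥ (t+13)n + 1`). -/
theorem window_ab {t n p : ℕ} (ht : 8 * n ≤ t * n) (hn : 1 ≤ n) (hF : t * n + 13 * n < 2 * p) :
    5 ≤ p ∧ (bLin (t * n) (t * n + 2 * n) n 0 + 2 : ℤ) < (p : ℤ) ^ 2 := by
  refine ⟨by omega, ?_⟩
  rw [ab_zero]
  have h1 : ((t * n + 13 * n + 1 : ℕ) : ℤ) ≤ 2 * p := by exact_mod_cast (show t * n + 13 * n + 1 ≤ 2 * p by omega)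
  have h2 : (11 : ℤ) ≤ p := by exact_mod_cast (show 11 ≤ p by omega)
  have h3 : (11 : ℤ) * p ≤ (p : ℤ) * p := mul_le_mul_of_nonneg_right h2 (by positivity)
  push_cast at h1 ⊢
  have ht' : (8 : ℤ) * n ≤ t * n := by exact_mod_cast ht
  nlinarith

/-- `p ≤ d = (2t+21)n`. -/
theorem le_dOf_ab {t n p : ℕ} (h : p ≤ 2 * (t * n) + 21 * n) : (p : ℤ) ≤ dOf (bLin (t * n) (t * n + 2 * n) n) := by
  rw [dOf_ab]; exact_mod_cast h

/-- `p ≤ b₀ = (3t+14)n`. -/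
theorem le_b0_ab {t n p : ℕ} (h : p ≤ 3 * (t * n) + 14 * n) : (p : ℤ) ≤ bLin (t * n) (t * n + 2 * n) n 0 := by
  rw [ab_zero]; exact_mod_cast h

/-- The parity flag of `b₀ = (3t+14)n` for even `tn`. -/
theorem oddFlag_even {t n : ℕ} (h : (t * n) % 2 = 0) : decide (¬ (2 : ℤ) ∣ bLin (t * n) (t * n + 2 * n) n 0) = false := by
  rw [ab_zero, decide_eq_false_iff_not, not_not]
  exact ⟨((3 * (t * n) + 14 * n) / 2 : ℕ), by push_cast; omega⟩

/-- The parity flag of `b₀ = (3t+14)n` for odd `tn`. -/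
theorem oddFlag_odd {t n : ℕ} (h : (t * n) % 2 = 1) : decide (¬ (2 : ℤ) ∣ bLin (t * n) (t * n + 2 * n) n 0) = true := by
  rw [ab_zero, decide_eq_true_iff]
  intro hd
  omega

/-- **THEOREM LB on the family, direction 7**: `casLB ≤ v_p(Cas₇)` in the first period (`t ≥ 8`). -/
theorem cas_ge_casLB {t n p : ℕ} (ht : 8 * n ≤ t * n) (hn : 1 ≤ n) (hprime : p.Prime) (hF : t * n + 13 * n < 2 * p)
    (hcas : casoratian (bLin (t * n) (t * n + 2 * n) n) 7 ≠ 0) :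
    casLB (bLin (t * n) (t * n + 2 * n) n) p ≤ padicValRat p (casoratian (bLin (t * n) (t * n + 2 * n) n) 7) := by
  obtain ⟨hp5, hwin⟩ := window_ab ht hn hF
  exact casoratianClassBound_holds _ 7 p (inPolytope_ab t n) (by norm_num) le_rfl (inPolytope_shift_ab t hn) hprime hp5 hwin hcas

/-! ## §1 `casLB` on `(t+7)n < p ≤ (t+13)n` (all `t ≥ 8`) -/

section Cells
variable {t n p : ℕ} [Fact p.Prime]

/-- `(t+7, t+8]`: `casLB ≥ −9`. -/
theorem casLB_a7 (ht : 8 * n ≤ t * n) (hn : 1 ≤ n) (hA : t * n + 7 * n < p) (hB : p ≤ t * n + 8 * n) (hp2 : p % 2 = 1) :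
    (-9 : ℤ) ≤ casLB (bLin (t * n) (t * n + 2 * n) n) p := by
  rcases casLB_of_cover' (cover_a7 ht hn hA hB hp2) (checkM_a7 _) (by norm_num) (fun _ => by norm_num) with ⟨h0, -⟩ | h
  · rw [h0]; norm_num
  · linarith

/-- `(t+8, t+9]`: `casLB ≥ −7`. -/
theorem casLB_a8 (ht : 8 * n ≤ t * n) (hn : 1 ≤ n) (hA : t * n + 8 * n < p) (hB : p ≤ t * n + 9 * n) (hp2 : p % 2 = 1) :
    (-7 : ℤ) ≤ casLB (bLin (t * n) (t * n + 2 * n) n) p := by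
  rcases casLB_of_cover' (cover_a8 ht hn hA hB hp2) (checkM_a8 _) (by norm_num) (fun _ => by norm_num) with ⟨h0, -⟩ | h
  · rw [h0]; norm_num
  · linarith

/-- `(t+9, t+10]`: `casLB ≥ −5`. -/
theorem casLB_a9 (ht : 8 * n ≤ t * n) (hn : 1 ≤ n) (hA : t * n + 9 * n < p) (hB : p ≤ t * n + 10 * n) (hp2 : p % 2 = 1) :
    (-5 : ℤ) ≤ casLB (bLin (t * n) (t * n + 2 * n) n) p := by
  rcases casLB_of_cover' (cover_a9 ht hn hA hB hp2) (checkM_a9 _) (by norm_num) (fun _ => by norm_num) with ⟨h0, -⟩ | h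
  · rw [h0]; norm_num
  · linarith

/-- `(t+10, t+11]`: `casLB ≥ −3`. -/
theorem casLB_a10 (ht : 8 * n ≤ t * n) (hn : 1 ≤ n) (hA : t * n + 10 * n < p) (hB : p ≤ t * n + 11 * n) (hp2 : p % 2 = 1) :
    (-3 : ℤ) ≤ casLB (bLin (t * n) (t * n + 2 * n) n) p := by
  rcases casLB_of_cover' (cover_a10 ht hn hA hB hp2) (StairTS3.checkM_c36 _) (by norm_num) (fun _ => by norm_num) with ⟨h0, -⟩ | h
  · rw [h0]; norm_num
  · linarith

/-- `(t+11, t+12]`: `casLB ≥ −1`. -/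
theorem casLB_a11 (ht : 8 * n ≤ t * n) (hn : 1 ≤ n) (hA : t * n + 11 * n < p) (hB : p ≤ t * n + 12 * n) (hp2 : p % 2 = 1) :
    (-1 : ℤ) ≤ casLB (bLin (t * n) (t * n + 2 * n) n) p := by
  rcases casLB_of_cover' (cover_a11 ht hn hA hB hp2) (checkM_a11 _) (by norm_num)
    (fun h => absurd h (by rw [dOf_ab]; omega)) with ⟨h0, -⟩ | h
  · rw [h0]; norm_num
  · linarith

/-- `(t+12, t+13]`: `casLB ≥ 0`. -/
theorem casLB_a12 (ht : 8 * n ≤ t * n) (hn : 1 ≤ n) (hA : t * n + 12 * n < p) (hB : p ≤ t * n + 13 * n) (hp2 : p % 2 = 1) :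
    (0 : ℤ) ≤ casLB (bLin (t * n) (t * n + 2 * n) n) p := by
  rcases casLB_of_cover' (cover_a12 ht hn hA hB hp2) (StairTS3.checkM_c41 _) (by norm_num)
    (fun h => absurd h (by rw [dOf_ab]; omega)) with ⟨h0, -⟩ | h
  · rw [h0]
  · linarith

end Cells

/-! ## §2 The deep cells `(t+13)n < 2p`, `p ≤ (t+2)n` in the frame `(10, [1,−6,−6,1])` -/

/-- **`⌊d/p⌋ = 3` deep cells** (`(t+13)n < 2p`, `3p ≤ (2t+21)n`, `p ≤ (t+2)n`; three θ-strips with covers valid from `t ≥ 14, 12, 10`, the bounds being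
forced by the strip): `v_p(Cas₇) ≥ −12` by THEOREM L5 (`cover_L5`; degree condition `6p ≤ 2d + 1` from `3p ≤ d`). -/
theorem cas_ge_e3 {t n p : ℕ} (ht : 8 * n ≤ t * n) (hn : 1 ≤ n) (hprime : p.Prime)
    (hA : t * n + 13 * n < 2 * p) (hB : 3 * p ≤ 2 * (t * n) + 21 * n) (hC : p ≤ t * n + 2 * n)
    (hcas : casoratian (bLin (t * n) (t * n + 2 * n) n) 7 ≠ 0) :
    (-12 : ℤ) ≤ padicValRat p (casoratian (bLin (t * n) (t * n + 2 * n) n) 7) := by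
  haveI : Fact p.Prime := ⟨hprime⟩
  have hp2 : p % 2 = 1 := Nat.odd_iff.1 (hprime.odd_of_ne_two (by omega))
  obtain ⟨hp5, hwin⟩ := window_ab ht hn hA
  have hb := inPolytope_ab t n
  have hb' := inPolytope_shift_ab t hn
  have hpb : (p : ℤ) ≤ bLin (t * n) (t * n + 2 * n) n 0 := le_b0_ab (by omega)
  have hdeg : (p : ℤ) * ((10 : ℕ) - 4 : ℤ) ≤ 2 * dOf (bLin (t * n) (t * n + 2 * n) n) + 1 := by
    rw [dOf_ab]; push_cast
    have : (3 * p : ℤ) ≤ 2 * (t * n) + 21 * n := by exact_mod_cast hB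
    linarith
  have hT : ([1, -6, -6, 1] : List ℤ).reverse = [1, -6, -6, 1] := by decide
  have go : ∀ {TY : List (List ℤ × Bool)}, Cover (bLin (t * n) (t * n + 2 * n) n) p TY →
      checkL5 (decide (¬ (2 : ℤ) ∣ bLin (t * n) (t * n + 2 * n) n 0)) TY 10 [1, -6, -6, 1] = true →
      (-12 : ℤ) ≤ padicValRat p (casoratian (bLin (t * n) (t * n + 2 * n) n) 7) :=
    fun hcov hchk => cover_L5 hb hb' (by norm_num) le_rfl hprime hp5 hpb hwin hcov (M := 10) (by norm_num) (by decide) hT hchk hdeg (by norm_num) hcas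
  have ht10 : 10 * n ≤ t * n := succ_mul_le_of_mul_lt (a := 9) (by omega)
  rcases Nat.mod_two_eq_zero_or_one (t * n) with hr | hr
  · by_cases h0 : p ≤ t * n
    · have ht14 : 14 * n ≤ t * n := succ_mul_le_of_mul_lt (a := 13) (by omega)
      exact go (cover_e3a_ev ht14 hn hA hB h0 hp2 hr) (by rw [oddFlag_even hr]; exact checkL5_e3a_ev)
    by_cases h1 : p ≤ t * n + n
    · have ht12 : 12 * n ≤ t * n := succ_mul_le_of_mul_lt (a := 11) (by omega)
      exact go (cover_e3b_ev ht12 hn (by omega) hB h1 hA hp2 hr) (by rw [oddFlag_even hr]; exact checkL5_e3b_ev)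
    · exact go (cover_e3c_ev ht10 hn (by omega) hB hC hA hp2 hr) (by rw [oddFlag_even hr]; exact checkL5_e3c_ev)
  · have hno : n % 2 = 1 := Nat.odd_iff.mp (Nat.odd_mul.mp (Nat.odd_iff.mpr hr)).2
    by_cases h0 : p ≤ t * n
    · have ht14 : 14 * n ≤ t * n := succ_mul_le_of_mul_lt (a := 13) (by omega)
      exact go (cover_e3a_od ht14 hn hA hB h0 hp2 hr hno) (by rw [oddFlag_odd hr]; exact checkL5_e3a_od)
    by_cases h1 : p ≤ t * n + n
    · have ht12 : 12 * n ≤ t * n := succ_mul_le_of_mul_lt (a := 11) (by omega)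
      exact go (cover_e3b_od ht12 hn (by omega) hB h1 hA hp2 hr hno) (by rw [oddFlag_odd hr]; exact checkL5_e3b_od)
    · exact go (cover_e3c_od ht10 hn (by omega) hB hC hA hp2 hr hno) (by rw [oddFlag_odd hr]; exact checkL5_e3c_od)

/-- **`⌊d/p⌋ = 2` deep cell** (`(2t+21)n < 3p`, `p ≤ (t+2)n`, first period; forces `t ≥ 16`): `v_p(Cas₇) ≥ −13` by THEOREM A⁗′ (`lawA4_holds`) in the
frame `(10, [1,−6,−6,1])`, the `LawA4Classes` clauses from the covers `cover_e2_ev/od` through `DenomLaw.clausesL5_of_cover`. -/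
theorem cas_ge_e2 {t n p : ℕ} (hn : 1 ≤ n) (hprime : p.Prime)
    (hA : 2 * (t * n) + 21 * n < 3 * p) (hB : p ≤ t * n + 2 * n) (hF : t * n + 13 * n < 2 * p)
    (hcas : casoratian (bLin (t * n) (t * n + 2 * n) n) 7 ≠ 0) :
    (-13 : ℤ) ≤ padicValRat p (casoratian (bLin (t * n) (t * n + 2 * n) n) 7) := by
  haveI : Fact p.Prime := ⟨hprime⟩
  have ht : 16 * n ≤ t * n := succ_mul_le_of_mul_lt (a := 15) (by omega)
  have hp2 : p % 2 = 1 := Nat.odd_iff.1 (hprime.odd_of_ne_two (by omega))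
  obtain ⟨hp5, hwin⟩ := window_ab (by omega) hn hF
  have hb := inPolytope_ab t n
  have hb' := inPolytope_shift_ab t hn
  have hpb : (p : ℤ) ≤ bLin (t * n) (t * n + 2 * n) n 0 := le_b0_ab (by omega)
  have hT : ([1, -6, -6, 1] : List ℤ).reverse = [1, -6, -6, 1] := by decide
  rcases Nat.mod_two_eq_zero_or_one (t * n) with hr | hr
  · obtain ⟨hCl, -⟩ := clausesL5_of_cover (cover_e2_ev ht hn hA hB hF hp2 hr) (M := 10) (T := [1, -6, -6, 1])
      (by rw [oddFlag_even hr]; exact checkL5_e2_ev)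
    have h := lawA4_apply lawA4_holds _ p 7 10 [1, -6, -6, 1] hb hb' (by norm_num) le_rfl hprime hp5 hpb hwin (by norm_num) (by decide) hT hCl hcas
    push_cast at h; linarith
  · have hno : n % 2 = 1 := Nat.odd_iff.mp (Nat.odd_mul.mp (Nat.odd_iff.mpr hr)).2
    obtain ⟨hCl, -⟩ := clausesL5_of_cover (cover_e2_od ht hn hA hB hF hp2 hr hno) (M := 10) (T := [1, -6, -6, 1])
      (by rw [oddFlag_odd hr]; exact checkL5_e2_od)
    have h := lawA4_apply lawA4_holds _ p 7 10 [1, -6, -6, 1] hb hb' (by norm_num) le_rfl hprime hp5 hpb hwin (by norm_num) (by decide) hT hCl hcas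
    push_cast at h; linarith

/-! ## §3 `C⋆` on the family (profile checks; the profile `i + c < 6` / `c < i + k + 2` does not depend on `t`, `n`) -/

/-- Profile bound: for `p > (t+c)·n` only parameters with `6 − i > c` and blocks with `i + k + 2 > c` can reach `p`. -/
theorem cStar_ab_le_of {t n p c K : ℕ} (hp : t * n + c * n < p)
    (hdec : ((List.finRange 7).permutations'.all fun l : List (Fin 7) => decide (
      ((univ : Finset (Fin 5)).filter fun s => (l.getD (s.val + 1) 0).val + c < 6).card +
      ((univ : Finset (Fin 6)).filter fun s => c < (l.getD s.val 0).val + (l.getD (s.val + 1) 0).val + 2).card ≤ K)) = true) :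
    cStar (bLin (t * n) (t * n + 2 * n) n) p ≤ K := by
  have hp' : ((t : ℤ) + c) * n < p := by
    have h := hp; zify at h; linarith
  have hn0 : (0 : ℤ) ≤ n := by positivity
  refine cStar_le_of_profile (fun i : Fin 7 => i.val + c < 6) (fun i k : Fin 7 => c < i.val + k.val + 2) K ?_ ?_ hdec
  · intro i hi
    rw [ab_param] at hi
    by_contra hc
    push Not at hc
    have hc' : ((t : ℤ) + 6 - (i.val : ℤ)) * n ≤ ((t : ℤ) + c) * n := mul_le_mul_of_nonneg_right (by omega) hn0
    linarith
  · intro i k hik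
    rw [ab_block] at hik
    by_contra hc
    push Not at hc
    have hc' : ((t : ℤ) + i.val + k.val + 2) * n ≤ ((t : ℤ) + c) * n := mul_le_mul_of_nonneg_right (by omega) hn0
    linarith

/-- `C⋆ ≤ 10` for `p > (t+2)n`. -/
theorem cStar_ab_le_ten {t n p : ℕ} (hp : t * n + 2 * n < p) : cStar (bLin (t * n) (t * n + 2 * n) n) p ≤ 10 :=
  cStar_ab_le_of hp (by decide +kernel)
/-- `C⋆ ≤ 9` for `p > (t+3)n`. -/
theorem cStar_ab_le_nine {t n p : ℕ} (hp : t * n + 3 * n < p) : cStar (bLin (t * n) (t * n + 2 * n) n) p ≤ 9 :=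
  cStar_ab_le_of hp (by decide +kernel)
/-- `C⋆ ≤ 8` for `p > (t+4)n`. -/
theorem cStar_ab_le_eight {t n p : ℕ} (hp : t * n + 4 * n < p) : cStar (bLin (t * n) (t * n + 2 * n) n) p ≤ 8 :=
  cStar_ab_le_of hp (by decide +kernel)
/-- `C⋆ ≤ 7` for `p > (t+5)n`. -/
theorem cStar_ab_le_seven {t n p : ℕ} (hp : t * n + 5 * n < p) : cStar (bLin (t * n) (t * n + 2 * n) n) p ≤ 7 :=
  cStar_ab_le_of hp (by decide +kernel)
/-- `C⋆ ≤ 6` for `p > (t+6)n`. -/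
theorem cStar_ab_le_six {t n p : ℕ} (hp : t * n + 6 * n < p) : cStar (bLin (t * n) (t * n + 2 * n) n) p ≤ 6 :=
  cStar_ab_le_of hp (by decide +kernel)
/-- `C⋆ ≤ 5` for `p > (t+8)n`. -/
theorem cStar_ab_le_five {t n p : ℕ} (hp : t * n + 8 * n < p) : cStar (bLin (t * n) (t * n + 2 * n) n) p ≤ 5 :=
  cStar_ab_le_of hp (by decide +kernel)
/-- `C⋆ ≤ 4` for `p > (t+9)n`. -/
theorem cStar_ab_le_four {t n p : ℕ} (hp : t * n + 9 * n < p) : cStar (bLin (t * n) (t * n + 2 * n) n) p ≤ 4 :=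
  cStar_ab_le_of hp (by decide +kernel)
/-- `C⋆ ≤ 3` for `p > (t+10)n`. -/
theorem cStar_ab_le_three {t n p : ℕ} (hp : t * n + 10 * n < p) : cStar (bLin (t * n) (t * n + 2 * n) n) p ≤ 3 :=
  cStar_ab_le_of hp (by decide +kernel)

end Summit.KontsevichZagierPeriods.Zeta5Search.ABFamFP
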